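import Summits.QuantumFields.BalabanUV.Beta.D1BFx.SplitPackaged
import Summits.QuantumFields.BalabanUV.Beta.D1BFx.ContactCount
import Summits.QuantumFields.BalabanUV.Beta.D1BFx.FrozenLegProfile

/-!
# `BalabanUV.Beta.D1BFx.TadpoleRest` — road «BF-x» for binder row D1, slot (REST), the `RestIdx` range `Sum.inl (Fin 5 × Fin 3)`:
# THE FIFTEEN GLUON TADPOLE WORDS `restK_tad (s, r)` ARE BOUNDED, AT EVERY BLOCK SIZE, BY `|ω_gl|·|c_s|·n⁻⁸·(2ρ+1)⁴·ρ²·½·|F|²·C₀·Cw·Zl(δ)²`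
# for an entry-bounded leg piece (`C₀`) and a LOCAL slot table (bi-localised at its two bonds at one common rate `(Cw, δ)`, finitely supported in
# the bond separation with sup-radius `ρ`) — leaf A6 (`ContactCount`) INSTANTIATED on this range; the packaged (REST)/(CONV) binders of
# `Assembly.hT_of_slots` for the range follow, with the n-uniformity isolated in ONE displayed inequality on the weights

HONEST DEPENDENCY (page 1, mandatory): continuum YM on T⁴ ⇐ BetaPertH ∧ nine spine estimates (0/9 proved); BetaPertH ⇐ (D1) ∧ (D4) ∧
CAP+tail; G-an2-4 gates asym, D1 and NE2/3/4.  HONEST FRAMING (cell contract, verbatim): «discharging `BetaPertH` makes Bałaban's UV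
stability UNCONDITIONAL — a real constructive-QFT result; it is NOT the continuum limit and NOT the Clay problem.»  THIS MODULE DISCHARGES
NOTHING of the wall: it is [folklore] bookkeeping BY NAME over leaf A6 `ContactCount` (`abs_tadpole_le_of_entryBound`,
`abs_fullSum_weighted_le_of_support`, `exists_tendsto_psum_weighted_of_support`, `abs_sum_mul_le_of_convex`), the owner's `Assembly` ∕ `SplitInstance` ∕
`SplitPackaged` (`fullSum_const_mul`, `sum_uniform_resSite`, `restK_tad`, `KrPk`), my lineage's `FineHessianLegGrades` (`legPiece`, `frozenLeg`,
`diagPart`, `offPart`) and, for the displayed instances of the entry bounds, T1 `GluonLeg.abs_Ga_le` and `FrozenLegProfile.abs_gfrz_d0_of_gProf`.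
No `def`, no `Prop` minted, nothing printed asserted, no citation, 0 sorry.  The leg `A`, the table `W`, the weights and the constants are
ARBITRARY parameters: nothing about Bałaban's operators is asserted.  0 wall binders; NOT the (K) slot, NOT D1, NOT `BetaPertH`, NOT continuum, NOT Clay.

ABSOLUTE RULE (cell charter, verbatim): «No internally-minted statement may enter as a cited fact. Every hypothesis is either kernel-proved in
this package or a verbatim quotation of a PUBLISHED theorem with page reference. The manuscript(s) under audit are NOT citable for their own
disputed steps — they are the thing under adjudication; programme-internal (2001/route/tribunal) claims are never citable.»

WHY (owner d1-p2-g2, `SPLIT-SPEC.md` v1.1 §4 «(REST) one leaf per `RestIdx` range … A6∕A5.0: `restK_tad`»; `LEAVES-BFx.md` INTEGRATION #6 «tad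
(Fin 5 × Fin 3) OPEN (A6/A5.0)»; journal l.15231 «Remaining `RestIdx` ranges (claimable, state the range): `inl (Fin 5 × Fin 3)` tadpole words»).
The (REST) slot of `D1BFx/Assembly` asks, for every REST word `τ`, `∀ n ≥ 2, |Σ_{b ∈ image resSite} n⁻⁴ · fullSum (Kr τ n b)| ≤ CR τ`.  For the gluon
tadpole words `restK_tad (s, r) = w ↦ ω_gl·(c_s·(n⁻⁸·(w_μw_ν·baseKer (tadpoleTableA (legPiece n a g r) (W_s) μ ν) b w)))` (`SplitInstance.restK_tad`;
`c_s = slotWt … s`, `W_s = slotTab WE WJ WΛ WR WQ s`) leaf A6's mechanism applies VERBATIM whenever the slot table is LOCAL: the word is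
`½·tadpole (legPiece r) (W_s μ (b + w) ν b)`, the second-order vertex of a local operator couples only nearby bonds (`W_s κ u λ u′ = 0` for
`‖u − u′‖∞ > ρ`), so the word is finitely supported in `w`; and each coefficient sees the leg only through the SUP of its entries
(`abs_tadpole_le_of_entryBound`), so no decay of the leg — whose rate is `∼ 1/n` — is spent.  The slots of record that are NOT local in this
sense (block-structured second jets, e.g. of the `R`-term) are A5.0's (`UnitLoopCount`) and are NOT treated here: every hypothesis below is
on ONE slot table, so the owner instantiates slot by slot.  The n-UNIFORMITY of the resulting bound is EXACTLY the displayed inequality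
`|ω_gl n|·|c_s n|·n⁻⁸·T(ρ, C₀ n, Cw n, δ n) ≤ CR` on the loop weight, the slot weight and the entry∕localisation constants — the units question of
slot (K) ∕ CHECK-N0 ∕ (R45), displayed as a hypothesis and ruled NOWHERE in this file (with the tree's printed entry bound `|Ga| ≤ n²/γ₀(4,a)`,
`GluonLeg.abs_Ga_le`, `C₀ n` grows like `n²`; whether `ω_gl n·c_s n·n⁻⁸` compensates is the weights' owners' business).

CONTENT (all [folklore]; `|F|` = `Fintype.card F`; `T(ρ, C₀, Cw, δ) := (2ρ+1)⁴·(ρ²·(½·(|F|·(|F|·(C₀·Cw)·Zl 4 δ)·Zl 4 δ)))`, written out, never named).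
* §1 GENERIC WORD over any fibre: `baseKer_tadpoleTableA_eq_zero_of_far` (support), `abs_baseKer_tadpoleTableA_le` (coefficient), `tadpoleT_nonneg`,
  **`abs_fullSum_tadpoleWord_le`** (`|fullSum (w ↦ c·(w_μw_ν·baseKer (tadpoleTableA A W μ ν) b w))| ≤ |c|·T`), `conv_tadpoleWord_of_support` ((CONV) from
  the support alone).
* §2 ENTRY BOUNDS OF THE LEG PIECES: `abs_frozenLeg_le`, `abs_diagPart_le`, `abs_offPart_le`, **`abs_legPiece_le`** (`≤ CG + Cg` for all three pieces from
  `|Ga| ≤ CG`, `|g| ≤ Cg`); the tree's displayed instance of `CG` is T1's `GluonLeg.abs_Ga_le` (`n²/γ₀(4,a)`), and `abs_gfrz_le` bounds the road's frozen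
  profile (R-10′) by the same constant.
* §3 THE WORDS AT FIXED `(n, b)`: `restK_tad_eq_const_mul` (the word as `c·(w_μw_ν·baseKer …)` with `c = ω_gl·c_s·n⁻⁸`), **`abs_fullSum_restK_tad_le`**,
  `conv_restK_tad_of_support`.
* §4 BASE-POINT AVERAGE AND THE PACKAGED BINDERS: **`abs_avg_fullSum_restK_tad_le`** (fixed `n`, convexity of the uniform weights), and against the
  owner's n-packaging `SplitPackaged.KrPk`: **`hKr_tad_packaged`** ((CONV) for the range, from locality alone) and **`hR_tad_packaged`** — the (REST)
  binder of `Assembly.hT_of_slots` ∕ `abs_defect_le_of_slots` for `τ = Sum.inl (s, r)`, ∀ `n ≥ 2`, from: entry bounds `CG n`, `Cg n`; ONE slot's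
  common-rate localisation `(Cw n, δ n)` and separation support `ρ`; and the displayed weight inequality `hCR`.
Unit `b2b-balaban-beta-d1-formalise-leaf-03` (gen 4), D1 formalisation swarm; `LEAVES-BFx.md` row A6 ∕ (REST) (sub-leaf «D1-BFx-REST-tad»).
-/

noncomputable section

namespace Summit.QuantumFields.BalabanUV.Beta.D1BFx.TadpoleRest

open Finset Filter Topology
open scoped BigOperators
open Literature.MathematicalPhysics.QuantumFieldTheory.Balaban1983to89
open Literature.MathematicalPhysics.QuantumFieldTheory.Balaban1983to89.Beta
open Literature.MathematicalPhysics.QuantumFieldTheory.Balaban1983to89.B5Prop11Lattice (gammaZero)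
open ExpKernelCalculus (Site MKer BiLoc tadpole Zl Zl_nonneg)
open DyadicShell (Pt toReal supNorm)
open WindowIdentification (psum fullSum fullSum_const_mul)
open DressedMomentNormalisation (resSite)
open Summit.QuantumFields.BalabanUV.Beta.D1BFx.MomentTransferPeriodic (baseKer)
open Summit.QuantumFields.BalabanUV.Beta.D1BFx.GluonLeg (Ga abs_Ga_le)
open Summit.QuantumFields.BalabanUV.Beta.D1BFx.ReducedKernel (TableR)
open Summit.QuantumFields.BalabanUV.Beta.D1BFx.DressedTablesLeg (tadpoleTableA tadpoleTableA_apply)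
open Summit.QuantumFields.BalabanUV.Beta.D1BFx.ContactCount (abs_tadpole_le_of_entryBound abs_fullSum_weighted_le_of_support
  exists_tendsto_psum_weighted_of_support abs_sum_mul_le_of_convex)
open Summit.QuantumFields.BalabanUV.Beta.D1BFx.Assembly (exists_tendsto_psum_const_mul sum_uniform_resSite uniform_resSite_nonneg)
open Summit.QuantumFields.BalabanUV.Beta.D1BFx.FineHessianSectors (slotWt slotTab)
open Summit.QuantumFields.BalabanUV.Beta.D1BFx.FineHessianLegGrades (diagPart offPart frozenLeg frozenLeg_apply legPiece legPiece_zero legPiece_one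
  legPiece_two)
open Summit.QuantumFields.BalabanUV.Beta.D1BFx.FrozenLegProfile (gfrz gProf abs_gfrz_d0_of_gProf)
open Summit.QuantumFields.BalabanUV.Beta.D1BFx.SplitInstance (RestIdx restK restK_tad)
open Summit.QuantumFields.BalabanUV.Beta.D1BFx.SplitPackaged (KrPk)

/-! ## §1 The generic tadpole word at a base site: support, coefficient bound, weighted full sum, (CONV) -/

section Generic

variable {F : Type*} [Fintype F] {A : MKer 4 F} {W : Fin 4 → Site 4 → Fin 4 → Site 4 → MKer 4 F} {C₀ Cw δ : ℝ} {ρ : ℕ}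

/-- [folklore] **SUPPORT.**  If the table vanishes for bond separations beyond sup-radius `ρ` (`W κ u λ u′ = 0` whenever `ρ < ‖u − u′‖∞`), then the
base-point tadpole word `w ↦ baseKer (tadpoleTableA A W μ ν) b w = ½·tadpole A (W μ (b + w) ν b)` vanishes for `ρ < ‖w‖∞`, at EVERY base site `b`. -/
theorem baseKer_tadpoleTableA_eq_zero_of_far (hsupp : ∀ κ u l u', ρ < supNorm (u - u') → W κ u l u' = 0) (μ ν : Fin 4) (b w : Pt)
    (hw : ρ < supNorm w) : baseKer (tadpoleTableA A W μ ν) b w = 0 := by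
  rw [baseKer, tadpoleTableA_apply, hsupp μ (b + w) ν b (by rwa [add_sub_cancel_left]), StepDriftWitness.tadpole_zero, mul_zero]

/-- [folklore] **COEFFICIENT.**  Entry-bounded leg `|A x y a b| ≤ C₀` (`C₀ ≥ 0`) and a table bi-localised at its two bonds at rate `δ > 0` with constant `Cw`:
`|baseKer (tadpoleTableA A W μ ν) b w| ≤ ½·|F|·(|F|·C₀·Cw·Zl 4 δ)·Zl 4 δ` — uniformly in `μ ν b w`, no decay of `A` used (`ContactCount.abs_tadpole_le_of_entryBound`). -/
theorem abs_baseKer_tadpoleTableA_le (hC₀ : 0 ≤ C₀) (hA : ∀ x y a b, |A x y a b| ≤ C₀) (hW : ∀ κ u l u', BiLoc (W κ u l u') u u' Cw δ)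
    (hδ : 0 < δ) (μ ν : Fin 4) (b w : Pt) :
    |baseKer (tadpoleTableA A W μ ν) b w| ≤
      (1 / 2 : ℝ) * ((Fintype.card F : ℝ) * ((Fintype.card F : ℝ) * (C₀ * Cw) * Zl 4 δ) * Zl 4 δ) := by
  rw [baseKer, tadpoleTableA_apply, abs_mul, abs_of_pos (by norm_num : (0 : ℝ) < 1 / 2)]
  exact mul_le_mul_of_nonneg_left (abs_tadpole_le_of_entryBound hC₀ hA (hW μ (b + w) ν b) hδ) (by norm_num)

/-- [folklore] The coefficient bound is nonnegative (empty fibre: `|F| = 0`; otherwise `Cw ≥ 0` is read off the localisation bound at one entry). -/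
theorem tadpoleT_nonneg (hC₀ : 0 ≤ C₀) (hW : ∀ κ u l u', BiLoc (W κ u l u') u u' Cw δ) (hδ : 0 < δ) :
    0 ≤ (1 / 2 : ℝ) * ((Fintype.card F : ℝ) * ((Fintype.card F : ℝ) * (C₀ * Cw) * Zl 4 δ) * Zl 4 δ) := by
  rcases isEmpty_or_nonempty F with hF | ⟨⟨a⟩⟩
  · simp [Fintype.card_eq_zero]
  · have hCw : 0 ≤ Cw := (hW 0 0 0 0).nonneg a
    have hZ : 0 ≤ Zl 4 δ := Zl_nonneg hδ
    positivity

/-- [folklore] **THE GENERIC TADPOLE WORD HAS A BLOCK-SIZE-FREE WEIGHTED FULL SUM** (leaf A6 at a base site, with a scalar prefactor `c`): entry-bounded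
leg, table bi-localised at its bonds at one common rate and finitely supported in the bond separation ⟹
`|fullSum (w ↦ c·(w_μw_ν·baseKer (tadpoleTableA A W μ ν) b w))| ≤ |c|·(2ρ+1)⁴·ρ²·½·|F|·(|F|·C₀·Cw·Zl 4 δ)·Zl 4 δ` for every base site `b`. -/
theorem abs_fullSum_tadpoleWord_le (hC₀ : 0 ≤ C₀) (hA : ∀ x y a b, |A x y a b| ≤ C₀) (hW : ∀ κ u l u', BiLoc (W κ u l u') u u' Cw δ)
    (hδ : 0 < δ) (hsupp : ∀ κ u l u', ρ < supNorm (u - u') → W κ u l u' = 0) (c : ℝ) (μ ν : Fin 4) (b : Pt) :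
    |fullSum (fun w : Pt => c * (toReal w μ * toReal w ν * baseKer (tadpoleTableA A W μ ν) b w))| ≤
      |c| * ((2 * (ρ : ℝ) + 1) ^ 4 *
        ((ρ : ℝ) ^ 2 * ((1 / 2 : ℝ) * ((Fintype.card F : ℝ) * ((Fintype.card F : ℝ) * (C₀ * Cw) * Zl 4 δ) * Zl 4 δ)))) := by
  have hfar : ∀ w : Pt, ρ < supNorm w → baseKer (tadpoleTableA A W μ ν) b w = 0 :=
    fun w hw => baseKer_tadpoleTableA_eq_zero_of_far hsupp μ ν b w hw
  rw [fullSum_const_mul c (exists_tendsto_psum_weighted_of_support hfar μ ν), abs_mul]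
  exact mul_le_mul_of_nonneg_left
    (abs_fullSum_weighted_le_of_support (tadpoleT_nonneg hC₀ hW hδ) hfar
      (fun w _ => abs_baseKer_tadpoleTableA_le hC₀ hA hW hδ μ ν b w) μ ν) (abs_nonneg c)

/-- [folklore] **(CONV) FROM LOCALITY ALONE**: the punctured partial sums of the generic tadpole word converge (they are eventually constant). -/
theorem conv_tadpoleWord_of_support (hsupp : ∀ κ u l u', ρ < supNorm (u - u') → W κ u l u' = 0) (c : ℝ) (μ ν : Fin 4) (b : Pt) :
    ∃ B, Tendsto (psum (fun w : Pt => c * (toReal w μ * toReal w ν * baseKer (tadpoleTableA A W μ ν) b w))) atTop (𝓝 B) :=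
  exists_tendsto_psum_const_mul c
    (exists_tendsto_psum_weighted_of_support (fun w hw => baseKer_tadpoleTableA_eq_zero_of_far hsupp μ ν b w hw) μ ν)

end Generic

/-! ## §2 Entry bounds of the three leg pieces -/

section Legs

variable {D : ℕ} {F : Type*} [DecidableEq F]

/-- [folklore] The frozen leg of a bounded profile is entry-bounded by the same constant: `|g v| ≤ Cg` ⟹ `|(frozenLeg g) x y a b| ≤ Cg`. -/
theorem abs_frozenLeg_le {g : Site D → ℝ} {Cg : ℝ} (hg : ∀ v, |g v| ≤ Cg) (x y : Site D) (a b : F) :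
    |(frozenLeg g : MKer D F) x y a b| ≤ Cg := by
  rw [frozenLeg_apply]
  split_ifs
  · exact hg _
  · rw [abs_zero]; exact (abs_nonneg _).trans (hg 0)

/-- [folklore] The fibre-diagonal part of an entry-bounded kernel is entry-bounded by the same constant. -/
theorem abs_diagPart_le {A : MKer D F} {C : ℝ} (hA : ∀ x y a b, |A x y a b| ≤ C) (x y : Site D) (a b : F) : |diagPart A x y a b| ≤ C := by
  unfold diagPart
  split_ifs
  · exact hA x y a b
  · rw [abs_zero]; exact (abs_nonneg _).trans (hA x y a b)

/-- [folklore] The fibre-off-diagonal part of an entry-bounded kernel is entry-bounded by the same constant. -/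
theorem abs_offPart_le {A : MKer D F} {C : ℝ} (hA : ∀ x y a b, |A x y a b| ≤ C) (x y : Site D) (a b : F) : |offPart A x y a b| ≤ C := by
  unfold offPart
  split_ifs
  · rw [abs_zero]; exact (abs_nonneg _).trans (hA x y a b)
  · exact hA x y a b

variable (n : ℕ) [NeZero n] (a : ℝ) {g : Site 4 → ℝ} {CG Cg : ℝ}

/-- [folklore] **ALL THREE LEG PIECES ARE ENTRY-BOUNDED BY `CG + Cg`** when `|Ga n a x y κ λ| ≤ CG` and `|g v| ≤ Cg`: `frozenLeg g` by `Cg`, the graded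
difference `diagPart Ga − frozenLeg g` by `CG + Cg`, `offPart Ga` by `CG` (both constants are `≥ 0`, read off one entry each). -/
theorem abs_legPiece_le (hGa : ∀ x y κ l, |Ga n a x y κ l| ≤ CG) (hg : ∀ v, |g v| ≤ Cg) (r : Fin 3) (x y : Site 4) (κ l : Fin 4) :
    |legPiece n a g r x y κ l| ≤ CG + Cg := by
  have hCG : 0 ≤ CG := (abs_nonneg _).trans (hGa 0 0 0 0)
  have hCg : 0 ≤ Cg := (abs_nonneg _).trans (hg 0)
  fin_cases r
  · exact (abs_frozenLeg_le hg x y κ l).trans (by linarith)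
  · exact (abs_sub _ _).trans (add_le_add (abs_diagPart_le hGa x y κ l) (abs_frozenLeg_le hg x y κ l))
  · exact (abs_offPart_le hGa x y κ l).trans (by linarith)

/-- [folklore] THE TREE'S DISPLAYED INSTANCE OF `CG` IS T1's `GluonLeg.abs_Ga_le` (`|Ga n a x y κ λ| ≤ n²/γ₀(4,a)`, n-DEPENDENT as printed); THE SAME
CONSTANT BOUNDS THE ROAD'S FROZEN PROFILE `gfrz n a b` (R-10′: an average of 64 diagonal entries of `Ga`; convexity `FrozenLegProfile.abs_gfrz_d0_of_gProf`). -/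
theorem abs_gfrz_le (hn : 1 ≤ n) (ha : 0 < a) (b v : Pt) : |gfrz n a b v| ≤ ((n : ℕ) : ℝ) ^ 2 * (gammaZero 4 a)⁻¹ :=
  abs_gfrz_d0_of_gProf n b v fun ε κ => abs_Ga_le n a hn ha b (b + FrozenLegProfile.sgnVec ε v) κ κ

end Legs

/-! ## §3 The fifteen gluon tadpole words at a fixed block size and base site -/

section Words

variable (n : ℕ) [NeZero n] (a : ℝ) (g : Pt → ℝ) (cE cΛ cR cK cQ cE₂ cJ4 cΛ₂ cR₂ cQ₂ x₀ : ℝ) (WE WJ WΛ WR WQ : TableR)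
  (ωgl ωgh lam N : ℝ) (μ ν : Fin 4) (b : Pt)

/-- [folklore] The tadpole word `(s, r)` as ONE scalar times the generic word: `restK … (Sum.inl (s,r)) = w ↦ (ω_gl·c_s·n⁻⁸)·(w_μw_ν·baseKer (tadpoleTableA (legPiece r) (W_s) μ ν) b w)`. -/
theorem restK_tad_eq_const_mul (x : Fin 5 × Fin 3) :
    restK n a g cE cΛ cR cK cQ cE₂ cJ4 cΛ₂ cR₂ cQ₂ x₀ WE WJ WΛ WR WQ ωgl ωgh lam N μ ν b (Sum.inl x) =
      fun w : Pt => (ωgl * slotWt cE₂ cJ4 cΛ₂ cR₂ cQ₂ x.1 * ((n : ℝ) ^ 8)⁻¹) *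
        (toReal w μ * toReal w ν * baseKer (tadpoleTableA (legPiece n a g x.2) (slotTab WE WJ WΛ WR WQ x.1) μ ν) b w) := by
  funext w
  rw [restK_tad]
  ring

variable {g} {C₀ Cw δ : ℝ} {ρ : ℕ}

/-- [folklore] **THE GLUON TADPOLE WORD `(s, r)` AT FIXED `(n, b)`**: leg piece `r` entry-bounded by `C₀ ≥ 0`, slot table `s` bi-localised at its two bonds with
`(Cw, δ)`, `δ > 0`, and supported in bond separation `≤ ρ` ⟹
`|fullSum (restK … (Sum.inl (s,r)))| ≤ |ω_gl|·|c_s|·n⁻⁸·(2ρ+1)⁴·ρ²·½·4·(4·C₀·Cw·Zl 4 δ)·Zl 4 δ` (`|Fin 4| = 4`). -/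
theorem abs_fullSum_restK_tad_le (x : Fin 5 × Fin 3) (hC₀ : 0 ≤ C₀) (hA : ∀ x' y κ l, |legPiece n a g x.2 x' y κ l| ≤ C₀)
    (hW : ∀ κ u l u', BiLoc (slotTab WE WJ WΛ WR WQ x.1 κ u l u') u u' Cw δ) (hδ : 0 < δ)
    (hsupp : ∀ κ u l u', ρ < supNorm (u - u') → slotTab WE WJ WΛ WR WQ x.1 κ u l u' = 0) :
    |fullSum (restK n a g cE cΛ cR cK cQ cE₂ cJ4 cΛ₂ cR₂ cQ₂ x₀ WE WJ WΛ WR WQ ωgl ωgh lam N μ ν b (Sum.inl x))| ≤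
      |ωgl| * |slotWt cE₂ cJ4 cΛ₂ cR₂ cQ₂ x.1| * ((n : ℝ) ^ 8)⁻¹ * ((2 * (ρ : ℝ) + 1) ^ 4 *
        ((ρ : ℝ) ^ 2 * ((1 / 2 : ℝ) * ((4 : ℝ) * ((4 : ℝ) * (C₀ * Cw) * Zl 4 δ) * Zl 4 δ)))) := by
  have h := abs_fullSum_tadpoleWord_le hC₀ hA hW hδ hsupp (ωgl * slotWt cE₂ cJ4 cΛ₂ cR₂ cQ₂ x.1 * ((n : ℝ) ^ 8)⁻¹) μ ν b
  rw [restK_tad_eq_const_mul]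
  simp only [Fintype.card_fin, Nat.cast_ofNat] at h
  rwa [abs_mul, abs_mul, abs_of_nonneg (by positivity : (0 : ℝ) ≤ ((n : ℝ) ^ 8)⁻¹)] at h

/-- [folklore] **(CONV) FOR THE WORD `(s, r)` FROM THE LOCALITY OF SLOT `s` ALONE** (no `Spr`∕`BiLoc` needed). -/
theorem conv_restK_tad_of_support (x : Fin 5 × Fin 3) (hsupp : ∀ κ u l u', ρ < supNorm (u - u') → slotTab WE WJ WΛ WR WQ x.1 κ u l u' = 0) :
    ∃ B, Tendsto (psum (restK n a g cE cΛ cR cK cQ cE₂ cJ4 cΛ₂ cR₂ cQ₂ x₀ WE WJ WΛ WR WQ ωgl ωgh lam N μ ν b (Sum.inl x))) atTop (𝓝 B) := by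
  rw [restK_tad_eq_const_mul]
  exact conv_tadpoleWord_of_support hsupp _ μ ν b

/-! ## §4 The base-point average at fixed `n`; the packaged (CONV) and (REST) binders for the range -/

/-- [folklore] **BASE-POINT AVERAGE AT FIXED `n`** (uniform weights `n⁻⁴` on the residue sites are convex: `Assembly.sum_uniform_resSite`; the profile may
depend on the base site, `gb b`): under the hypotheses of `abs_fullSum_restK_tad_le` at every base site,
`|Σ_{b ∈ image resSite} n⁻⁴ · fullSum (restK … (gb b) … b (Sum.inl (s,r)))| ≤` the same constant. -/
theorem abs_avg_fullSum_restK_tad_le {gb : Pt → Pt → ℝ} (x : Fin 5 × Fin 3) (hC₀ : 0 ≤ C₀)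
    (hA : ∀ b x' y κ l, |legPiece n a (gb b) x.2 x' y κ l| ≤ C₀)
    (hW : ∀ κ u l u', BiLoc (slotTab WE WJ WΛ WR WQ x.1 κ u l u') u u' Cw δ) (hδ : 0 < δ)
    (hsupp : ∀ κ u l u', ρ < supNorm (u - u') → slotTab WE WJ WΛ WR WQ x.1 κ u l u' = 0) :
    |∑ b ∈ (univ : Finset (Fin 4 → Fin n)).image resSite, ((n : ℝ) ^ 4)⁻¹ *
        fullSum (restK n a (gb b) cE cΛ cR cK cQ cE₂ cJ4 cΛ₂ cR₂ cQ₂ x₀ WE WJ WΛ WR WQ ωgl ωgh lam N μ ν b (Sum.inl x))| ≤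
      |ωgl| * |slotWt cE₂ cJ4 cΛ₂ cR₂ cQ₂ x.1| * ((n : ℝ) ^ 8)⁻¹ * ((2 * (ρ : ℝ) + 1) ^ 4 *
        ((ρ : ℝ) ^ 2 * ((1 / 2 : ℝ) * ((4 : ℝ) * ((4 : ℝ) * (C₀ * Cw) * Zl 4 δ) * Zl 4 δ)))) :=
  abs_sum_mul_le_of_convex _ (fun b hb => uniform_resSite_nonneg n b hb) (sum_uniform_resSite (NeZero.ne n))
    fun b _ => abs_fullSum_restK_tad_le n a cE cΛ cR cK cQ cE₂ cJ4 cΛ₂ cR₂ cQ₂ x₀ WE WJ WΛ WR WQ ωgl ωgh lam N μ ν b x hC₀ (hA b) hW hδ hsupp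

end Words

section Packaged

variable {a : ℝ} {gp : ℕ → Pt → Pt → ℝ} {cE cVH cΛ cR cK cQ cE₂ cJ4 cΛ₂ cR₂ cQ₂ x₀ : ℕ → ℝ} {WE WJ WΛ WR WQ : ℕ → TableR}
  {ωgl ωgh lam : ℕ → ℝ} {N : ℝ} {μ ν : Fin 4} {CG Cg Cw δ : ℕ → ℝ} {ρ : ℕ} {CR : ℝ}

/-- [folklore] **THE (CONV) BINDER `hKr` OF `Assembly.hT_of_slots` FOR THE RANGE `Sum.inl`**, against the owner's packaging `SplitPackaged.KrPk`, from the
locality of slot `s` at every block size alone: `∀ n ≥ 2, ∀ b ∈ image resSite, ∃ B, Tendsto (psum (KrPk … (Sum.inl (s,r)) n b)) atTop (𝓝 B)`. -/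
theorem hKr_tad_packaged (x : Fin 5 × Fin 3)
    (hsupp : ∀ n κ u l u', ρ < supNorm (u - u') → slotTab (WE n) (WJ n) (WΛ n) (WR n) (WQ n) x.1 κ u l u' = 0) :
    ∀ n : ℕ, 2 ≤ n → ∀ b ∈ (univ : Finset (Fin 4 → Fin n)).image resSite, ∃ B,
      Tendsto (psum (KrPk a gp cE cΛ cR cK cQ cE₂ cJ4 cΛ₂ cR₂ cQ₂ x₀ WE WJ WΛ WR WQ ωgl ωgh lam N μ ν (Sum.inl x) n b)) atTop (𝓝 B) := by
  intro n hn b _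
  have h1 : 1 ≤ n := le_trans one_le_two hn
  haveI : NeZero n := ⟨Nat.one_le_iff_ne_zero.mp h1⟩
  have e : KrPk a gp cE cΛ cR cK cQ cE₂ cJ4 cΛ₂ cR₂ cQ₂ x₀ WE WJ WΛ WR WQ ωgl ωgh lam N μ ν (Sum.inl x) n b =
      restK n a (gp n b) (cE n) (cΛ n) (cR n) (cK n) (cQ n) (cE₂ n) (cJ4 n) (cΛ₂ n) (cR₂ n) (cQ₂ n) (x₀ n) (WE n) (WJ n) (WΛ n) (WR n) (WQ n)
        (ωgl n) (ωgh n) (lam n) N μ ν b (Sum.inl x) := by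
    funext w; simp only [KrPk, dif_pos h1]
  rw [e]
  exact conv_restK_tad_of_support n a (cE n) (cΛ n) (cR n) (cK n) (cQ n) (cE₂ n) (cJ4 n) (cΛ₂ n) (cR₂ n) (cQ₂ n) (x₀ n) (WE n) (WJ n) (WΛ n)
    (WR n) (WQ n) (ωgl n) (ωgh n) (lam n) N μ ν b x (hsupp n)

/-- [folklore] **THE (REST) BINDER `hR` OF `Assembly.hT_of_slots` ∕ `abs_defect_le_of_slots` FOR THE RANGE `Sum.inl` — THE FIFTEEN GLUON TADPOLE WORDS,
A6 CLASS**, against the owner's packaging `SplitPackaged.KrPk` (`Bset n = image resSite`, `wt n b = n⁻⁴`).  Inputs, for every block size `n ≥ 2`: the entry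
bounds `|Ga n a| ≤ CG n`, `|gp n b| ≤ Cg n` (every base site); for slot `s` the common-rate localisation `(Cw n, δ n)`, `δ n > 0`, and the locality
`W_s κ u λ u′ = 0` for `‖u − u′‖∞ > ρ`; and the DISPLAYED WEIGHT INEQUALITY
`|ω_gl n|·|c_s n|·n⁻⁸·(2ρ+1)⁴·ρ²·½·4·(4·(CG n + Cg n)·Cw n·Zl 4 (δ n))·Zl 4 (δ n) ≤ CR` (slot (K) ∕ CHECK-N0's units; ruled nowhere here).  Output:
`∀ n ≥ 2, |Σ_{b ∈ image resSite} n⁻⁴ · fullSum (KrPk … (Sum.inl (s,r)) n b)| ≤ CR`. -/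
theorem hR_tad_packaged (x : Fin 5 × Fin 3)
    (hGa : ∀ n : ℕ, 2 ≤ n → ∀ [NeZero n], ∀ x' y κ l, |Ga n a x' y κ l| ≤ CG n)
    (hgp : ∀ n : ℕ, 2 ≤ n → ∀ b v, |gp n b v| ≤ Cg n)
    (hW : ∀ n κ u l u', BiLoc (slotTab (WE n) (WJ n) (WΛ n) (WR n) (WQ n) x.1 κ u l u') u u' (Cw n) (δ n)) (hδ : ∀ n, 0 < δ n)
    (hsupp : ∀ n κ u l u', ρ < supNorm (u - u') → slotTab (WE n) (WJ n) (WΛ n) (WR n) (WQ n) x.1 κ u l u' = 0)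
    (hCR : ∀ n : ℕ, 2 ≤ n → |ωgl n| * |slotWt (cE₂ n) (cJ4 n) (cΛ₂ n) (cR₂ n) (cQ₂ n) x.1| * ((n : ℝ) ^ 8)⁻¹ * ((2 * (ρ : ℝ) + 1) ^ 4 *
        ((ρ : ℝ) ^ 2 * ((1 / 2 : ℝ) * ((4 : ℝ) * ((4 : ℝ) * ((CG n + Cg n) * Cw n) * Zl 4 (δ n)) * Zl 4 (δ n))))) ≤ CR) :
    ∀ n : ℕ, 2 ≤ n → |∑ b ∈ (univ : Finset (Fin 4 → Fin n)).image resSite, ((n : ℝ) ^ 4)⁻¹ *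
        fullSum (KrPk a gp cE cΛ cR cK cQ cE₂ cJ4 cΛ₂ cR₂ cQ₂ x₀ WE WJ WΛ WR WQ ωgl ωgh lam N μ ν (Sum.inl x) n b)| ≤ CR := by
  intro n hn
  have h1 : 1 ≤ n := le_trans one_le_two hn
  haveI : NeZero n := ⟨Nat.one_le_iff_ne_zero.mp h1⟩
  have e : ∀ b, KrPk a gp cE cΛ cR cK cQ cE₂ cJ4 cΛ₂ cR₂ cQ₂ x₀ WE WJ WΛ WR WQ ωgl ωgh lam N μ ν (Sum.inl x) n b =
      restK n a (gp n b) (cE n) (cΛ n) (cR n) (cK n) (cQ n) (cE₂ n) (cJ4 n) (cΛ₂ n) (cR₂ n) (cQ₂ n) (x₀ n) (WE n) (WJ n) (WΛ n) (WR n) (WQ n)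
        (ωgl n) (ωgh n) (lam n) N μ ν b (Sum.inl x) := by
    intro b; funext w; simp only [KrPk, dif_pos h1]
  simp only [e]
  have hCG : 0 ≤ CG n := (abs_nonneg _).trans (hGa n hn 0 0 0 0)
  have hCg : 0 ≤ Cg n := (abs_nonneg _).trans (hgp n hn 0 0)
  refine (abs_avg_fullSum_restK_tad_le n a (cE n) (cΛ n) (cR n) (cK n) (cQ n) (cE₂ n) (cJ4 n) (cΛ₂ n) (cR₂ n) (cQ₂ n) (x₀ n) (WE n) (WJ n)
    (WΛ n) (WR n) (WQ n) (ωgl n) (ωgh n) (lam n) N μ ν x (add_nonneg hCG hCg)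
    (fun b x' y κ l => abs_legPiece_le n a (hGa n hn) (hgp n hn b) x.2 x' y κ l) (hW n) (hδ n) (hsupp n)).trans (hCR n hn)

end Packaged

end Summit.QuantumFields.BalabanUV.Beta.D1BFx.TadpoleRest

end
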